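import Summits.AnomalousDissipation.AnomalousDissipation.Theses.TaylorCertificates
import Literature.Analysis.FunctionSpaces.TorusTestFunction

/-!
# Crux `TaylorCertificates.TaylorFloor` (stmt-AnomalousDissipation-14085) — crux-ideate round 1, ideator 2

NEGATIVE finding (memo `ONE-STEP-PHANTOM-r1-2.md` in the crux dir): the Taylor-class FLOOR certificate is false for EVERY
force, UNCONDITIONALLY — the forced stationary `h`-principle (E∀) = route support `ForcedStandingFlows` assumed by
`Cruxes/TaylorCertificatePair/PHANTOM-FLOOR.md` and by the route's calibration item `PhantomFloorLaw` (rev ≥ 6) is not needed: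
an APPROXIMATE standing flow with `L²`-small Reynolds stress does the same job, and ONE Beltrami–Nash step from rest
supplies it for every smooth divergence-free mean-zero `f` (tree: `BeltramiWaves`, `BeltramiWavesCurl`,
`BeltramiGeometricLemma`, `Antidivergence*`).

The route dropped the decl `TaylorFloor` at rev 6 (route-choice g2, 2026-08-16T00:46Z) and inlined its text under the
negation in `PhantomFloorLaw`; it is re-declared here verbatim so that the glue typechecks against the live tree (rev 9).

Typed here (statements; the only proofs are logic):
* `TaylorFloor` — verbatim the dropped crux (= the body negated in `Theses.TaylorCertificates.PhantomFloorLaw`);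
* `ApproximateStandingBath` — (B) for every `f` and `η > 0` a smooth div-free mean-zero `v` and a smooth symmetric stress `R`
  with `∫ (v ⊗ v) : ∇W + (f, W) = ∫ R : ∇W` for all smooth div-free `W`, `‖R_ij‖_{L²} ≤ η`, `(f, v) ≥ −η` (one-sided: all the kill uses);
* `FloorPhantomKill` — the `∀∃` form of `¬ TaylorFloor`; glue `not_taylorFloor_of_kill` (PROVED);
* `OneStepPhantomTheorem : Prop := ApproximateStandingBath → PacketLemma → FloorPhantomKill` — with the ROUTE's `PacketLemma`
  (support stmt-14032); paper proof: memo §2;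
* `phantomFloorLaw_of_oneStep` (PROVED): (B) and the one-step theorem give the route's support `PhantomFloorLaw` outright
  (its (E∀) hypothesis is then idle) — i.e. the calibration no longer leans on an unproved `h`-principle;
* `ApproximateStandingBathOfStandingFlows : Prop := ForcedStandingFlows → ApproximateStandingBath` (mollification; stated) —
  (B) is the WEAKER antecedent, implied both by (E∀) and by the explicit one-step bath.
-/

noncomputable section

open MeasureTheory
open scoped InnerProductSpace ENNReal

namespace Summit.AnomalousDissipation.AnomalousDissipation.Cruxes.TaylorFloor.OneStepPhantom

open Literature.Analysis.FunctionSpaces Literature.Analysis.FluidPDE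
open Summit.AnomalousDissipation.AnomalousDissipation.Theses.TaylorCertificates

local notation "𝕋³" => UnitAddTorus (Fin 3)
local notation "E³" => EuclideanSpace ℝ (Fin 3)
local notation "L2T" => Lp (EuclideanSpace ℝ (Fin 3)) 2 (volume : Measure (UnitAddTorus (Fin 3)))

/-- The dropped crux `TaylorFloor` (stmt-AnomalousDissipation-14085), verbatim: the FLOOR certified in the Taylor class. -/
def TaylorFloor : Prop :=
  ∃ f : 𝕋³ → E³, Torus.IsSmooth f ∧ Torus.IsDivFree f ∧ Torus.HasZeroMean f ∧
    ∃ (ε₀ C Θ ν₀ : ℝ), 0 < ε₀ ∧ 0 < ν₀ ∧ ∀ ν : ℝ, 0 < ν → ν < ν₀ →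
    ∃ (N : ℕ) (Φ₁ : Torus.CylindricalTest (Fin 3)) (θ₁ : ℝ), (N : ℝ) ≤ C * ν ^ (-(1 / 2 : ℝ)) ∧
    (∀ i, Torus.fourierTruncate N (Φ₁.g i) = Φ₁.g i) ∧ -Θ ≤ θ₁ ∧ θ₁ ≤ 0 ∧
    ∀ u : Torus.energySpace (Fin 3),
      let uf : 𝕋³ → E³ := ((u : L2T) : 𝕋³ → E³);
      let D : ℝ := ν * (Torus.eGradNormSq uf).toReal;
      let P : ℝ := Torus.pairing (u : L2T) f - D;
      Torus.eGradNormSq uf ≠ ⊤ → ‖u‖ ^ 2 ≤ 16 * (∫ x, ‖f x‖ ^ 2) / ν ^ 2 →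
      ε₀ ≤ D + Torus.nsGeneratorPairing ν f u (Φ₁.grad u) + 2 * θ₁ * P

/-- Sanity: the route's calibration item negates exactly this statement. -/
example : PhantomFloorLaw ↔ (ForcedStandingFlows → PacketLemma → ¬ TaylorFloor) := Iff.rfl

/-- **(B) approximate standing baths.** For every smooth divergence-free mean-zero force `f` on `T³` and every
`η > 0` there are a smooth divergence-free mean-zero field `v` and a smooth symmetric `2`-tensor `R` (columns
`R x j`) such that `div (v ⊗ v − R) + ∇p = f` weakly — i.e. `∫ ⟪v, (v·∇)W⟫ + ⟪f, W⟫ = ∫ ∑ⱼ ⟪R^{(j)}, ∂ⱼW⟫` for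
every smooth divergence-free `W` — with `‖R_ij‖_{L²} ≤ η` (only `∫‖R‖_{S₁} ≤ 3√3 η` is used downstream, so the
`L²`/Parseval form suffices and NO Schauder / stationary-phase estimate is needed) and `(f, v) ≥ −η` (ONE-SIDED —
the kill only needs `−2|θ₁|(a,f) ≤ 2Θη`; the one-step bath gives `|(f,v)| = O(1/n)`, an exact standing flow gives `(f,v) ≥ 0`).
CONSTRUCTION (memo §1, one Beltrami–Nash step from rest = the `q = 0 → 1` step of De Lellis–Székelyhidi 2013 /
Buckmaster–Vicol EMS Surv. 2020 = arXiv:1901.09023 §5.4–5.6.2 with the force absorbed into `R̊₀ = −T` and no time):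
`T := ∇Δ⁻¹f + (∇Δ⁻¹f)ᵀ` (symmetric, trace-free, `div T = f`), `e := 20‖T‖_{C⁰}`, `a_ξ := √e · γ_ξ(Id + T/e)`
(`IntermittentBeltrami.gamma`, `geometric_lemma`), `v := (2π·5n)⁻¹ curl ∑_{ξ∈Λ} a_ξ B_ξ e_{5nξ}`; the slow part of `v ⊗ v` is
`e Id + T` exactly (`bvec_mul_conj_add`), the pairs `ξ + ξ' ≠ 0` contribute `∇p_osc + G e_{5n(ξ+ξ')}` with
`G = O(‖a‖‖∇a‖)` by the Beltrami pairwise identity `(B_ξ ⊗ B_ξ' + B_ξ' ⊗ B_ξ)(ξ + ξ') = (B_ξ·B_ξ')(ξ + ξ')`, and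
`R := (∇H + ∇Hᵀ) + corrector products = O(1/n)` in `L²`, `H := Δ⁻¹(oscillatory forces)` (Parseval:
`‖G e_{λκ}‖_{Ḣ⁻¹} ≤ (‖G‖₂ + ‖∇G‖₂)/(πλ)`). Exact Fourier-side numerics: `toy/beltrami_pair_exact.py` (λ‖ρ‖_{Ḣ⁻¹} = 33.3 ± 0.1
over λ = 5…320 while the unprojected residual grows ∝ λ). UNPROVED (M-sized given the tree's Beltrami files). -/
def ApproximateStandingBath : Prop :=
  ∀ f : 𝕋³ → E³, Torus.IsSmooth f → Torus.IsDivFree f → Torus.HasZeroMean f →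
    ∀ η : ℝ, 0 < η →
    ∃ (v : 𝕋³ → E³) (R : 𝕋³ → Fin 3 → E³), Torus.IsSmooth v ∧ Torus.IsDivFree v ∧ Torus.HasZeroMean v ∧
      Torus.IsSmooth R ∧ (∀ x i j, R x i j = R x j i) ∧ (∀ i j, ∫ x, (R x i j) ^ 2 ≤ η ^ 2) ∧
      (∀ W : 𝕋³ → E³, Torus.IsSmooth W → Torus.IsDivFree W →
        ∫ x, (⟪v x, Torus.convect v W x⟫_ℝ + ⟪f x, W x⟫_ℝ) =
          ∫ x, ∑ j, ⟪R x j, Torus.partialDeriv j W x⟫_ℝ) ∧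
      -η ≤ ∫ x, ⟪f x, v x⟫_ℝ

/-- **FLOOR killed by phantoms** — the `∀∃` form of `¬ TaylorFloor`: for every admissible force and all constants there are
arbitrarily small `ν` at which EVERY Taylor-class floor certificate `(N, Φ₁, θ₁)` is violated by some finite-enstrophy state
of the Leray ball. On paper (memo §2): `u = a` or `u = a + ŵ`, `a = P_M v` the truncation at `M = ⌊ν^{-1/2}⌋` of an
approximate standing bath `v` of (B) with `η = η(ε₀, C, Θ, f)` fixed BEFORE `ν`, and `ŵ` a packet of (P) against
`W = Φ₁'(a)` riding the most compressive direction of its strain. -/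
def FloorPhantomKill : Prop :=
  ∀ f : 𝕋³ → E³, Torus.IsSmooth f → Torus.IsDivFree f → Torus.HasZeroMean f →
    ∀ (ε₀ C Θ ν₀ : ℝ), 0 < ε₀ → 0 < ν₀ → ∃ ν : ℝ, 0 < ν ∧ ν < ν₀ ∧
    ∀ (N : ℕ) (Φ₁ : Torus.CylindricalTest (Fin 3)) (θ₁ : ℝ), (N : ℝ) ≤ C * ν ^ (-(1 / 2 : ℝ)) →
    (∀ i, Torus.fourierTruncate N (Φ₁.g i) = Φ₁.g i) → -Θ ≤ θ₁ → θ₁ ≤ 0 →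
    ∃ u : Torus.energySpace (Fin 3),
      let uf : 𝕋³ → E³ := ((u : L2T) : 𝕋³ → E³);
      let D : ℝ := ν * (Torus.eGradNormSq uf).toReal;
      let P : ℝ := Torus.pairing (u : L2T) f - D;
      Torus.eGradNormSq uf ≠ ⊤ ∧ ‖u‖ ^ 2 ≤ 16 * (∫ x, ‖f x‖ ^ 2) / ν ^ 2 ∧
      D + Torus.nsGeneratorPairing ν f u (Φ₁.grad u) + 2 * θ₁ * P < ε₀

/-- Glue (pure logic): the kill statement refutes `TaylorFloor`. -/
theorem not_taylorFloor_of_kill : FloorPhantomKill → ¬ TaylorFloor := by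
  intro hK ⟨f, hfs, hfd, hfz, ε₀, C, Θ, ν₀, hε₀, hν₀, h⟩
  obtain ⟨ν, hν, hνν₀, hkill⟩ := hK f hfs hfd hfz ε₀ C Θ ν₀ hε₀ hν₀
  obtain ⟨N, Φ₁, θ₁, hN, hΦ₁, hθ₁, hθ₁', hu⟩ := h ν hν hνν₀
  obtain ⟨u, hfin, hball, hlt⟩ := hkill N Φ₁ θ₁ hN hΦ₁ hθ₁ hθ₁'
  exact absurd (hu u hfin hball) (not_le.mpr hlt)

/-- The theorem of the (negative) line, stated with the ROUTE's packet lemma (support stmt-14032): approximate standing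
baths and packets kill every Taylor-class floor certificate, for every force (paper proof: ONE-STEP-PHANTOM-r1-2.md §2 =
PHANTOM-FLOOR.md §2 with the exact weak Euler identity replaced by the defect identity of (B) and `(f,v) ≥ 0` by `(f,v) ≥ −η`). -/
def OneStepPhantomTheorem : Prop :=
  ApproximateStandingBath → PacketLemma → FloorPhantomKill

/-- Hence, granted (B) and the one-step theorem, the route's calibration item `PhantomFloorLaw` holds with its
`ForcedStandingFlows` hypothesis IDLE — the Taylor floor is dead without any `h`-principle. -/
theorem phantomFloorLaw_of_oneStep (hB : ApproximateStandingBath) (hT : OneStepPhantomTheorem) : PhantomFloorLaw :=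
  fun _hE hP => not_taylorFloor_of_kill (hT hB hP)

/-- And the unconditional form. -/
theorem not_taylorFloor (hB : ApproximateStandingBath) (hT : OneStepPhantomTheorem) (hP : PacketLemma) : ¬ TaylorFloor :=
  not_taylorFloor_of_kill (hT hB hP)

/-- (B) is the weaker antecedent: an exact bounded standing flow of (E∀) yields approximate standing baths by
mollification (`a := v ⋆ φ_δ` smooth div-free mean-zero; `R := a ⊗ a − (v ⊗ v) ⋆ φ_δ + ℛ(f ⋆ φ_δ − f) → 0` in `L²` since
`v ∈ L^∞ ⊂ L⁴` and `f` is smooth; `(f, a) → (f, v) ≥ 0`). Stated, M-sized. -/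
def ApproximateStandingBathOfStandingFlows : Prop :=
  ForcedStandingFlows → ApproximateStandingBath

end Summit.AnomalousDissipation.AnomalousDissipation.Cruxes.TaylorFloor.OneStepPhantom
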